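import Summits.QuantumFields.YangMills.Theorems.PencilRigidityWeakCouplingHypercubicLimitGapOfRPSpectralWindow
import HarnessLib

/-!
# `RPSpectral ⇒ HasLatticeMassGap` (crux `WeakCouplingHypercubicLimit`, stmt-QuantumFields-16120, line `Sketch`, r14, stub K5, part 2)

Registered stub `stub_gapOfRPSpectral` of the lead's skeleton r14 (continuation lead c6):

  `RPSpectral r sch Δ C → (∀ᶠ k, 0 ≤ β_k) → HasLatticeMassGap r sch (Δ / 2)`

— the RP-spectral RELATIVE clustering of reflected slab functionals at separations `n < S/2` on all tori `S ≥ L_k`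
(clause (b) of `IRInputs`) already implies the volume-uniform lattice mass gap for ALL pairs of local gauge-invariant
observables at ALL separations `n ≤ S` (clause (a), `HasLatticeMassGap`), at half the rate, for every compact `G`.
No spectral theory: the window `n ∈ (S/2, S]` is closed by reflection positivity of Wilson's action on the ODD torus
(`mirror_window` of part 1 over `MirrorLogConvex.mirrorCorr_nonneg/_sq_le/_fold'`, K2 `stub_mirrorOfRPSpectral`,
K3 `stub_convexWindow`) and general pairs reduce to mirror correlators by K4 `stub_mirrorDomination`.

Refs: K. Osterwalder, E. Seiler, Ann. Phys. 110 (1978) 440, §2; E. Seiler, LNP 159 (1982) Ch. 2. [folklore]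
-/

noncomputable section

open MeasureTheory ProbabilityTheory Filter Topology
open Literature.MathematicalPhysics.QuantumFieldTheory hiding Site ZdEdge
open Literature.MathematicalPhysics.QuantumLattice
open Literature.MathematicalPhysics.AQFT
open Summit.QuantumFields.YangMills.Cruxes.HypercubicLimit.CouplingResponse
open Summit.QuantumFields.YangMills.Theorems.FiniteSusceptibilityWeakCoupling
open Summit.QuantumFields.YangMills.Theorems.FiniteSusceptibilityWeakCoupling.MirrorDominationAxis0
open Summit.QuantumFields.YangMills.Theorems.FiniteSusceptibilityWeakCoupling.MirrorLogConvex

namespace Summit.QuantumFields.YangMills.Theorems.WeakCouplingHypercubicLimit.TraceNormColdPressure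

open GapOfRPSpectral

/-- **Registered stub `stub_gapOfRPSpectral` (K5, line `Sketch`, r14): RP-spectral relative clustering implies the
volume-uniform lattice mass gap at half the rate** — `RPSpectral r sch Δ C → (∀ᶠ k, 0 ≤ β_k) → HasLatticeMassGap r sch (Δ/2)`,
for every compact `G`, every lattice representation and every scheme.  Per pair `(A, B)` (radius `R`, bound `B₀`): the
thermal constant is made non-negative (`stub_rpSpectralAnti` at `Δ' = Δ`); K2 gives the short-lag bounds for
`A, Aᴿ, B, Bᴿ` with a common offset `c`; eventually in `k` (`β_k ≥ 0`, `a_k ≤ 1`, `L_k` large since `a_k L_k → ∞`) and for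
`S ≥ L_k`: lags `n ≤ 2R + 4 + c` by the a-priori bound `2B₀² ≤ 2B₀² e^{(Δ/2)(2R+5+c)} e^{−(Δ/2) a_k n}`; larger lags by
`stub_mirrorDomination` and the window bounds (`mirror_window`) for `A`, `Aᴿ`, `Bᴿ` at lags `j₁, j₂ ≥ n − 1`:
`⟨A; τ_n B⟩² ≤ (2Ke)(Ke)` with `e = e^{−(Δ/2) a_k (n−1)}`, whence `|⟨A; τ_n B⟩| ≤ 2K e^{Δ/2} e^{−(Δ/2) a_k n}`. [folklore] -/
theorem stub_gapOfRPSpectral :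
    ∀ (G : Type) [Group G] [TopologicalSpace G] [IsTopologicalGroup G] [CompactSpace G]
      [MeasurableSpace G] [BorelSpace G] (r : LatticeRep G) (sch : SpeciesScheme (YMSpecies G)) (Δ C : ℝ),
      0 < Δ → (∀ᶠ k in atTop, 0 ≤ sch.β k) → RPSpectral r sch Δ C → HasLatticeMassGap r sch (Δ / 2) := by
  intro G _ _ _ _ _ _ r sch Δ C hΔ hβ hRP
  -- non-negative thermal constant
  have hRP' : RPSpectral r sch Δ (2 * max C 0) := stub_rpSpectralAnti G r sch Δ Δ C hΔ.le le_rfl hRP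
  obtain ⟨C₀, hC₀eq, hC₀⟩ : ∃ C₀ : ℝ, C₀ = 2 * max C 0 ∧ 0 ≤ C₀ :=
    ⟨_, rfl, mul_nonneg zero_le_two (le_max_right _ _)⟩
  rw [← hC₀eq] at hRP'
  intro A B
  -- a common time radius and a common bound
  obtain ⟨R, hRA, hRB⟩ : ∃ R : ℕ, (∀ e ∈ A.supp, (e.1 0).natAbs + 2 ≤ R) ∧
      ∀ e ∈ B.supp, (e.1 0).natAbs + 2 ≤ R := by
    refine ⟨((A.supp ∪ B.supp).sup fun e => (e.1 0).natAbs) + 2, fun e he => ?_, fun e he => ?_⟩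
    · have h := Finset.le_sup (f := fun e : Literature.MathematicalPhysics.QuantumLattice.ZdEdge 4 => (e.1 0).natAbs)
        (Finset.mem_union_left B.supp he)
      exact Nat.add_le_add_right h 2
    · have h := Finset.le_sup (f := fun e : Literature.MathematicalPhysics.QuantumLattice.ZdEdge 4 => (e.1 0).natAbs)
        (Finset.mem_union_right A.supp he)
      exact Nat.add_le_add_right h 2
  obtain ⟨BA, hBA⟩ := A.bounded
  obtain ⟨BB, hBB⟩ := B.bounded
  obtain ⟨B₀, hB₀⟩ : ∃ B₀ : ℝ, B₀ = max BA BB := ⟨_, rfl⟩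
  have hA0 : ∀ V, |A.F V| ≤ B₀ := fun V => (hBA V).trans (hB₀ ▸ le_max_left _ _)
  have hB0 : ∀ V, |B.F V| ≤ B₀ := fun V => (hBB V).trans (hB₀ ▸ le_max_right _ _)
  have hA0' : ∀ V, |(reflSpecies A).F V| ≤ B₀ := fun V => hA0 _
  have hB0' : ∀ V, |(reflSpecies B).F V| ≤ B₀ := fun V => hB0 _
  have hRA' := radius_reflSpecies_succ A hRA
  have hRB' := radius_reflSpecies_succ B hRB
  -- K2 for A, Aᴿ, B, Bᴿ
  obtain ⟨cA, hcA⟩ := stub_mirrorOfRPSpectral G r sch Δ C₀ hΔ.le hC₀ hRP' A R B₀ hRA hA0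
  obtain ⟨cA', hcA'⟩ := stub_mirrorOfRPSpectral G r sch Δ C₀ hΔ.le hC₀ hRP' (reflSpecies A) (R + 1) B₀ hRA' hA0'
  obtain ⟨cB, hcB⟩ := stub_mirrorOfRPSpectral G r sch Δ C₀ hΔ.le hC₀ hRP' B R B₀ hRB hB0
  obtain ⟨cB', hcB'⟩ := stub_mirrorOfRPSpectral G r sch Δ C₀ hΔ.le hC₀ hRP' (reflSpecies B) (R + 1) B₀ hRB' hB0'
  obtain ⟨c, hc⟩ : ∃ c : ℕ, c = max (max cA cA') (max cB cB') := ⟨_, rfl⟩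
  have hccA : cA ≤ c := by rw [hc]; exact le_max_of_le_left (le_max_left _ _)
  have hccA' : cA' ≤ c := by rw [hc]; exact le_max_of_le_left (le_max_right _ _)
  have hccB : cB ≤ c := by rw [hc]; exact le_max_of_le_right (le_max_left _ _)
  have hccB' : cB' ≤ c := by rw [hc]; exact le_max_of_le_right (le_max_right _ _)
  -- the scheme: `a_k < 1` and `L_k ≥ S₀` eventually
  have ha1 : ∀ᶠ k in atTop, sch.a k < 1 := sch.tendsto_a (Iio_mem_nhds zero_lt_one)
  obtain ⟨S₀, hS₀⟩ : ∃ S₀ : ℕ, S₀ = 4 * c + 4 * R + 16 := ⟨_, rfl⟩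
  have hL : ∀ᶠ k in atTop, (S₀ : ℝ) ≤ sch.a k * sch.L k := Filter.tendsto_atTop.1 sch.tendsto_L S₀
  -- the constants
  obtain ⟨K, hK⟩ : ∃ K : ℝ, K = (2 * Real.exp (Δ * (2 * c + 3)) + C₀) * B₀ ^ 2 := ⟨_, rfl⟩
  have hK0 : 0 ≤ K := by rw [hK]; positivity
  obtain ⟨n₁, hn₁⟩ : ∃ n₁ : ℕ, n₁ = 2 * R + 5 + c := ⟨_, rfl⟩
  refine ⟨2 * B₀ ^ 2 * Real.exp (Δ / 2 * n₁) + 2 * K * Real.exp (Δ / 2), ?_⟩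
  filter_upwards [hcA, hcA', hcB, hcB', hβ, ha1, hL] with k hkA hkA' hkB hkB' hkβ hka hkL
  intro S hS n hnS
  have hapos : 0 < sch.a k := sch.a_pos k
  have hΔa : 0 ≤ Δ * sch.a k := mul_nonneg hΔ.le hapos.le
  have hE : 0 ≤ Real.exp (-(Δ / 2 * (sch.a k * n))) := Real.exp_nonneg _
  have hterm1 : 0 ≤ 2 * B₀ ^ 2 * Real.exp (Δ / 2 * n₁) := by positivity
  have hterm2 : 0 ≤ 2 * K * Real.exp (Δ / 2) := by positivity
  -- `L_k ≥ S₀`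
  have hLk : S₀ ≤ sch.L k := by
    have h1 : sch.a k * sch.L k ≤ sch.L k := by
      have hL0 : (0 : ℝ) ≤ sch.L k := Nat.cast_nonneg _
      nlinarith
    exact_mod_cast hkL.trans h1
  have hSS : S₀ ≤ S := hLk.trans hS
  by_cases hn : n < n₁
  · -- small lags: a-priori bound
    have hap := abs_latticeConnectedCorr_le r (sch.β k) S n hA0 hB0
    refine hap.trans ?_
    have hexp : 1 ≤ Real.exp (Δ / 2 * n₁) * Real.exp (-(Δ / 2 * (sch.a k * n))) := by
      rw [← Real.exp_add]
      refine Real.one_le_exp ?_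
      have hnn : (n : ℝ) ≤ n₁ := by exact_mod_cast hn.le
      have hn0 : (0 : ℝ) ≤ n := Nat.cast_nonneg n
      have h1 : sch.a k * n ≤ n₁ := by nlinarith
      nlinarith
    have hB2 : 0 ≤ 2 * B₀ ^ 2 := by positivity
    calc 2 * B₀ ^ 2 = 2 * B₀ ^ 2 * 1 := (mul_one _).symm
      _ ≤ 2 * B₀ ^ 2 * (Real.exp (Δ / 2 * n₁) * Real.exp (-(Δ / 2 * (sch.a k * n)))) :=
          mul_le_mul_of_nonneg_left hexp hB2
      _ = 2 * B₀ ^ 2 * Real.exp (Δ / 2 * n₁) * Real.exp (-(Δ / 2 * (sch.a k * n))) := by ring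
      _ ≤ (2 * B₀ ^ 2 * Real.exp (Δ / 2 * n₁) + 2 * K * Real.exp (Δ / 2)) *
            Real.exp (-(Δ / 2 * (sch.a k * n))) := by
          refine mul_le_mul_of_nonneg_right ?_ hE
          linarith
  · have hn : n₁ ≤ n := not_lt.1 hn
    -- large lags: mirror domination + the three windows
    obtain ⟨j₁, j₂, hj1n, hj1S, hj2n, hj2S, h0A, h0A', h0B', hcs⟩ :=
      stub_mirrorDomination G r (sch.β k) hkβ A B R hRA hRB S n (by omega) (by omega) hnS
    -- short-lag inputs with the common offset `c`
    have hPA : ∀ m : ℕ, c ≤ m → 2 * (m + c) ≤ S →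
        |latticeConnectedCorr r.ρ (sch.β k) (2 * S + 1) A.F (fun V => A.F (cfgReflect V)) m| ≤
          2 * B₀ ^ 2 * Real.exp (-(Δ * sch.a k * ((m : ℝ) - c))) +
            C₀ * B₀ ^ 2 * Real.exp (-(Δ * sch.a k * S)) := fun m hm hmS =>
      shortLag_mono hΔa hccA (hkA S m hS (hccA.trans hm) (by omega))
    have hQA : ∀ m : ℕ, c ≤ m → 2 * (m + c) ≤ S →
        |latticeConnectedCorr r.ρ (sch.β k) (2 * S + 1) (fun V => A.F (cfgReflect V)) A.F m| ≤
          2 * B₀ ^ 2 * Real.exp (-(Δ * sch.a k * ((m : ℝ) - c))) +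
            C₀ * B₀ ^ 2 * Real.exp (-(Δ * sch.a k * S)) := fun m hm hmS => by
      rw [← mirrorCorr_reflSpecies r (sch.β k) A S m]
      exact shortLag_mono hΔa hccA' (hkA' S m hS (hccA'.trans hm) (by omega))
    have hPB : ∀ m : ℕ, c ≤ m → 2 * (m + c) ≤ S →
        |latticeConnectedCorr r.ρ (sch.β k) (2 * S + 1) B.F (fun V => B.F (cfgReflect V)) m| ≤
          2 * B₀ ^ 2 * Real.exp (-(Δ * sch.a k * ((m : ℝ) - c))) +
            C₀ * B₀ ^ 2 * Real.exp (-(Δ * sch.a k * S)) := fun m hm hmS =>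
      shortLag_mono hΔa hccB (hkB S m hS (hccB.trans hm) (by omega))
    have hQB : ∀ m : ℕ, c ≤ m → 2 * (m + c) ≤ S →
        |latticeConnectedCorr r.ρ (sch.β k) (2 * S + 1) (fun V => B.F (cfgReflect V)) B.F m| ≤
          2 * B₀ ^ 2 * Real.exp (-(Δ * sch.a k * ((m : ℝ) - c))) +
            C₀ * B₀ ^ 2 * Real.exp (-(Δ * sch.a k * S)) := fun m hm hmS => by
      rw [← mirrorCorr_reflSpecies r (sch.β k) B S m]
      exact shortLag_mono hΔa hccB' (hkB' S m hS (hccB'.trans hm) (by omega))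
    -- window for A
    have hWA := mirror_window r hkβ A hRA hΔ.le hapos hka.le hC₀ (c := c) (S := S) (by omega) hPA hQA
    -- window for Aᴿ (its `P`-form is `hQA`, its `Q`-form is `hPA`)
    have hWA' : ∀ j : ℕ, c ≤ j → j ≤ S →
        |latticeConnectedCorr r.ρ (sch.β k) (2 * S + 1) (fun V => A.F (cfgReflect V)) A.F j| ≤
          (2 * Real.exp (Δ * (2 * c + 3)) + C₀) * B₀ ^ 2 * Real.exp (-(Δ / 2 * (sch.a k * j))) := by
      have hP' : ∀ m : ℕ, c ≤ m → 2 * (m + c) ≤ S →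
          |latticeConnectedCorr r.ρ (sch.β k) (2 * S + 1) (reflSpecies A).F
              (fun V => (reflSpecies A).F (cfgReflect V)) m| ≤
            2 * B₀ ^ 2 * Real.exp (-(Δ * sch.a k * ((m : ℝ) - c))) +
              C₀ * B₀ ^ 2 * Real.exp (-(Δ * sch.a k * S)) := fun m hm hmS => by
        rw [mirrorCorr_reflSpecies r (sch.β k) A S m]
        exact hQA m hm hmS
      have hQ' : ∀ m : ℕ, c ≤ m → 2 * (m + c) ≤ S →
          |latticeConnectedCorr r.ρ (sch.β k) (2 * S + 1) (fun V => (reflSpecies A).F (cfgReflect V))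
              (reflSpecies A).F m| ≤
            2 * B₀ ^ 2 * Real.exp (-(Δ * sch.a k * ((m : ℝ) - c))) +
              C₀ * B₀ ^ 2 * Real.exp (-(Δ * sch.a k * S)) := fun m hm hmS => by
        rw [reflSpecies_reflSpecies_F_eq A]
        exact hPA m hm hmS
      have h := mirror_window r hkβ (reflSpecies A) hRA' hΔ.le hapos hka.le hC₀ (c := c) (S := S)
        (by omega) hP' hQ'
      intro j hj hjS
      have h' := h j hj hjS
      rwa [mirrorCorr_reflSpecies r (sch.β k) A S j] at h'
    -- window for Bᴿ
    have hWB' : ∀ j : ℕ, c ≤ j → j ≤ S →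
        |latticeConnectedCorr r.ρ (sch.β k) (2 * S + 1) (fun V => B.F (cfgReflect V)) B.F j| ≤
          (2 * Real.exp (Δ * (2 * c + 3)) + C₀) * B₀ ^ 2 * Real.exp (-(Δ / 2 * (sch.a k * j))) := by
      have hP' : ∀ m : ℕ, c ≤ m → 2 * (m + c) ≤ S →
          |latticeConnectedCorr r.ρ (sch.β k) (2 * S + 1) (reflSpecies B).F
              (fun V => (reflSpecies B).F (cfgReflect V)) m| ≤
            2 * B₀ ^ 2 * Real.exp (-(Δ * sch.a k * ((m : ℝ) - c))) +
              C₀ * B₀ ^ 2 * Real.exp (-(Δ * sch.a k * S)) := fun m hm hmS => by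
        rw [mirrorCorr_reflSpecies r (sch.β k) B S m]
        exact hQB m hm hmS
      have hQ' : ∀ m : ℕ, c ≤ m → 2 * (m + c) ≤ S →
          |latticeConnectedCorr r.ρ (sch.β k) (2 * S + 1) (fun V => (reflSpecies B).F (cfgReflect V))
              (reflSpecies B).F m| ≤
            2 * B₀ ^ 2 * Real.exp (-(Δ * sch.a k * ((m : ℝ) - c))) +
              C₀ * B₀ ^ 2 * Real.exp (-(Δ * sch.a k * S)) := fun m hm hmS => by
        rw [reflSpecies_reflSpecies_F_eq B]
        exact hPB m hm hmS
      have h := mirror_window r hkβ (reflSpecies B) hRB' hΔ.le hapos hka.le hC₀ (c := c) (S := S)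
        (by omega) hP' hQ'
      intro j hj hjS
      have h' := h j hj hjS
      rwa [mirrorCorr_reflSpecies r (sch.β k) B S j] at h'
    -- the three values met, all at lags `≥ n - 1`
    obtain ⟨e, he⟩ : ∃ e : ℝ, e = Real.exp (-(Δ / 2 * (sch.a k * ((n : ℝ) - 1)))) := ⟨_, rfl⟩
    have hej : ∀ j : ℕ, n ≤ j + 1 → Real.exp (-(Δ / 2 * (sch.a k * j))) ≤ e := fun j hj => by
      rw [he]
      refine Real.exp_le_exp.2 ?_
      have hj' : (n : ℝ) ≤ j + 1 := by exact_mod_cast hj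
      nlinarith
    have hKe : 0 ≤ K * e := mul_nonneg hK0 (by rw [he]; exact Real.exp_nonneg _)
    have h1 : latticeConnectedCorr r.ρ (sch.β k) (2 * S + 1) A.F (fun V => A.F (cfgReflect V)) j₁ ≤ K * e := by
      refine (le_abs_self _).trans ((hWA j₁ (by omega) hj1S).trans ?_)
      rw [hK]
      exact mul_le_mul_of_nonneg_left (hej j₁ hj1n) (by positivity)
    have h2 : latticeConnectedCorr r.ρ (sch.β k) (2 * S + 1) (fun V => A.F (cfgReflect V)) A.F j₁ ≤ K * e := by
      refine (le_abs_self _).trans ((hWA' j₁ (by omega) hj1S).trans ?_)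
      rw [hK]
      exact mul_le_mul_of_nonneg_left (hej j₁ hj1n) (by positivity)
    have h3 : latticeConnectedCorr r.ρ (sch.β k) (2 * S + 1) (fun V => B.F (cfgReflect V)) B.F j₂ ≤ K * e := by
      refine (le_abs_self _).trans ((hWB' j₂ (by omega) hj2S).trans ?_)
      rw [hK]
      exact mul_le_mul_of_nonneg_left (hej j₂ hj2n) (by positivity)
    have habs : |latticeConnectedCorr r.ρ (sch.β k) (2 * S + 1) A.F B.F n| ≤ 2 * (K * e) :=
      abs_le_of_sq_le_mul hcs (add_nonneg h0A h0A') h0B' (by linarith) (by linarith)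
    refine habs.trans ?_
    -- `2 K e ≤ 2 K e^{Δ/2} e^{-(Δ/2) a n}`
    have hee : e ≤ Real.exp (Δ / 2) * Real.exp (-(Δ / 2 * (sch.a k * n))) := by
      rw [he, ← Real.exp_add]
      refine Real.exp_le_exp.2 ?_
      nlinarith
    calc 2 * (K * e) ≤ 2 * (K * (Real.exp (Δ / 2) * Real.exp (-(Δ / 2 * (sch.a k * n))))) := by
          gcongr
      _ = 2 * K * Real.exp (Δ / 2) * Real.exp (-(Δ / 2 * (sch.a k * n))) := by ring
      _ ≤ (2 * B₀ ^ 2 * Real.exp (Δ / 2 * n₁) + 2 * K * Real.exp (Δ / 2)) *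
            Real.exp (-(Δ / 2 * (sch.a k * n))) := by
          refine mul_le_mul_of_nonneg_right ?_ hE
          linarith

end Summit.QuantumFields.YangMills.Theorems.WeakCouplingHypercubicLimit.TraceNormColdPressure

end
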